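import Summits.ResolutionOfSingularities.ResolutionOfSingularities.Theorems.HenselKeyChainLU
import Literature.AlgebraicGeometry.Resolution.KollarEtaleCoordinates
import Mathlib.RingTheory.Unramified.LocalStructure
import Mathlib.RingTheory.RegularLocalRing.Polynomial
import Mathlib.RingTheory.KrullDimension.Polynomial
import HarnessLib

/-!
# AdaptedChartHensel — decomp-res node «HenselLadder» PART VI ((K-H), lens-1 g22 ADDENDUM), tree companion

Content VERBATIM from PART VI of the decomp-res lens-1 g22 node `HOME/decomp-res-lens-1/g22/HenselLadder.lean`
(HOME = run/shared/lean/pub/decomp-res; ADDENDUM-g22.md), re-namespaced `…Theorems.AdaptedChartHensel` (one namespace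
across the three companion files `AdaptedChartHensel`, `AdaptedChartHensel2`, `AdaptedChartHensel3`, split for the
400-line cap), typed against the LANDED `Theorems.HenselKeyChainLU` (p803393), `Literature…KollarEtaleCoordinates`,
`Literature.RingTheory.Flat` (via the tree) and Mathlib's standard-étale API; nothing inlined; a pure addition (no
existing file touched).  Landing target:
`Summits/ResolutionOfSingularities/ResolutionOfSingularities/Theorems/AdaptedChartHensel.lean`
(`--kind proof --supports stmt-ResolutionOfSingularities-0641`, HELPER file of the host route `Valuative`).

WINDOW g23 item (K-H) (CRITIC-LEDGER row 167): THEOREM H (⟸) IN KERNEL — every rank-one place with residue field `k`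
that admits a (value-)ADAPTED REGULAR CHART on some finite-type model lies in the Hensel cell
`HenselKeyChainTopBelow k O`, MODULO THEOREM D typed as the hypothesis `TheoremD k` (window: «D admissible as a TYPED
hypothesis»; THEOREM D = g21 ADDENDUM, row 163a, to be landed as item (K-D) against `TheoremD k`).  The étale local
structure (EGA IV 18.4.6 (ii)) is NOT ported: it is assembled in kernel from miracle flatness (tree, EGA IV 6.1.5),
Kollár's unramified coordinates (tree), flat + unramified ⇒ étale (tree, EGA IV 17.6.1) and Mathlib's
`Algebra.IsEtaleAt.exists_isStandardEtale` (Stacks 00UE) + `StandardEtalePresentation`.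

THIS FILE: §VI.1 the typed objects `MonomiallyRational`, `TheoremD`, `ValueAdaptedRegularChart`; §VI.2 valuation transport
along a field embedding; §VI.3 the Hensel datum of a standard-étale presentation (`henselDatum_of_standardEtalePresentation`).
-/

noncomputable section

open IsLocalRing Literature.AlgebraicGeometry.Resolution
open Summit.ResolutionOfSingularities.ResolutionOfSingularities.Theorems
open Summit.ResolutionOfSingularities.ResolutionOfSingularities.Theorems.KeyChainLU
open Summit.ResolutionOfSingularities.ResolutionOfSingularities.Theorems.HenselKeyChainLU

namespace Summit.ResolutionOfSingularities.ResolutionOfSingularities.Theorems.AdaptedChartHensel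

section AdaptedChart

open Polynomial

variable {k : Type} [Field k] {K : Type} [Field K] [Algebra k K]

/-! ### VI.1 The typed objects -/

/-- **Monomially rational valued field in four variables** (the shape of the base of the Hensel cell):
`F = k(y₀, y₁, y₂, y₃)` purely transcendental on nonzero `yᵢ ∈ O`, the values of `y₀, y₁, y₂` are
`ℤ`-independent (a monomial `3`-frame) and span the value group over `ℚ`. [folklore] -/
def MonomiallyRational (k : Type) [Field k] {F : Type} [Field F] [Algebra k F]
    (O : ValuationSubring F) : Prop :=
  ∃ y : Fin 4 → F, (∀ i, y i ≠ 0) ∧ (∀ i, y i ∈ O) ∧ AlgebraicIndependent k y ∧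
    IntermediateField.adjoin k (Set.range y) = ⊤ ∧
    (∀ m : Fin 3 → ℤ, (∏ i : Fin 3, O.valuation (y (Fin.castSucc i)) ^ m i) = 1 → m = 0) ∧
    (∀ x : F, x ≠ 0 → ∃ E : ℕ, 0 < E ∧ ∃ m : Fin 3 → ℤ,
      O.valuation x ^ E = ∏ i : Fin 3, O.valuation (y (Fin.castSucc i)) ^ m i)

/-- **THEOREM D as a TYPED HYPOTHESIS** (critic rows 163a/167, item (K-D)): every rank-one, residually
rational, monomially rational valued function field `k(y₀, y₁, y₂, z)` carries an inductive binomial key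
chain (`KeyChainTopBelow`).  On paper: Kaplansky's key-polynomial construction over the monomial frame
(Spivakovsky / Herrera–Olalla–Mahboub–Spivakovsky key polynomials; Knaf–Kuhlmann 2005 §4).  It is the
rank-`2` item of the g21 route and is NOT proved here; this file USES it as `(hD : TheoremD k)`.
[KnafKuhlmann2005 = arXiv:math/0304201, Thm. 1.1, §4] [folklore] -/
def TheoremD (k : Type) [Field k] : Prop :=
  ∀ (F : Type) [Field F] [Algebra k F] (O : ValuationSubring F),
    Nonempty O.valuation.RankOne →
    (∀ y ∈ O, ∃ c : k, y - algebraMap k F c ∈ O.nonunits) →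
    MonomiallyRational k O → KeyChainTopBelow k O

/-- **Value-adapted regular chart** of `(K, v)` over `k` (THEOREM H's right-hand side, typed): a finitely
generated `k`-subalgebra `A ⊆ O` with `Frac A = K` whose local ring `A_𝔮` at the centre `𝔮 = 𝔪_v ∩ A`
is REGULAR of dimension `4` with a regular system of parameters `u₀, u₁, u₂, u₃ ∈ A` (they generate
`𝔪_{A_𝔮}`), such that the VALUES `v u₀, v u₁, v u₂` are `ℤ`-independent and span the value
group over `ℚ` ("value-adapted": the first three parameters carry a monomial `3`-frame of `v`).  The
residue-field condition `κ(v) = k` is NOT part of the chart; it is the separate binder `hκ` of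
`henselKeyChainTopBelow_of_adaptedRegularChart` (and it is necessary there). [folklore] -/
def ValueAdaptedRegularChart (k : Type) [Field k] {K : Type} [Field K] [Algebra k K]
    (O : ValuationSubring K) : Prop :=
  ∃ (A : Subalgebra k K) (hAO : A.toSubring ≤ O.toSubring) (u : Fin 4 → K) (hu : ∀ i, u i ∈ A),
    A.FG ∧ IsFractionRing A K ∧
    IsRegularLocalRing (Localization.AtPrime (centreIdeal A O hAO)) ∧
    ringKrullDim (Localization.AtPrime (centreIdeal A O hAO)) = 4 ∧
    IsLocalRing.maximalIdeal (Localization.AtPrime (centreIdeal A O hAO)) =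
      Ideal.span (Set.range fun i =>
        algebraMap A (Localization.AtPrime (centreIdeal A O hAO)) ⟨u i, hu i⟩) ∧
    (∀ m : Fin 3 → ℤ, (∏ i : Fin 3, O.valuation (u (Fin.castSucc i)) ^ m i) = 1 → m = 0) ∧
    (∀ x : K, x ≠ 0 → ∃ E : ℕ, 0 < E ∧ ∃ m : Fin 3 → ℤ,
      O.valuation x ^ E = ∏ i : Fin 3, O.valuation (u (Fin.castSucc i)) ^ m i)

/-! ### VI.2 Valuation transport along a field embedding -/

/-- The valuation `v ∘ ι` is equivalent to the valuation of the pulled-back ring `O.comap ι`.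
[folklore] -/
theorem isEquiv_comap_valuation {F : Type} [Field F] (ι : F →+* K) (O : ValuationSubring K) :
    (O.valuation.comap ι).IsEquiv (O.comap ι).valuation := by
  have hO : (O.valuation.comap ι).valuationSubring = O.comap ι := by
    ext x
    rw [Valuation.mem_valuationSubring_iff, ValuationSubring.mem_comap, Valuation.comap_apply,
      ValuationSubring.valuation_le_one_iff]
  rw [← hO]
  exact Valuation.isEquiv_valuation_valuationSubring _

/-- `comap_valuation_lt_one_iff`: Auxiliary step of the lens-1 g22 (K-H) calculus, VERBATIM from the lens file
tree/AdaptedChartHensel.lean (see the module docstring); the statement is its type. [folklore] -/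
theorem comap_valuation_lt_one_iff {F : Type} [Field F] (ι : F →+* K) (O : ValuationSubring K)
    (z : F) : (O.comap ι).valuation z < 1 ↔ O.valuation (ι z) < 1 := by
  rw [← (isEquiv_comap_valuation ι O).lt_one_iff_lt_one, Valuation.comap_apply]

/-- `comap_valuation_eq_one_iff`: Auxiliary step of the lens-1 g22 (K-H) calculus, VERBATIM from the lens file
tree/AdaptedChartHensel.lean (see the module docstring); the statement is its type. [folklore] -/
theorem comap_valuation_eq_one_iff {F : Type} [Field F] (ι : F →+* K) (O : ValuationSubring K)
    (z : F) : (O.comap ι).valuation z = 1 ↔ O.valuation (ι z) = 1 := by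
  rw [← (isEquiv_comap_valuation ι O).eq_one_iff_eq_one, Valuation.comap_apply]

/-- `comap_valuation_eq_iff`: Auxiliary step of the lens-1 g22 (K-H) calculus, VERBATIM from the lens file
tree/AdaptedChartHensel.lean (see the module docstring); the statement is its type. [folklore] -/
theorem comap_valuation_eq_iff {F : Type} [Field F] (ι : F →+* K) (O : ValuationSubring K)
    (z w : F) : (O.comap ι).valuation z = (O.comap ι).valuation w ↔
      O.valuation (ι z) = O.valuation (ι w) := by
  rw [← (isEquiv_comap_valuation ι O).eq_iff, Valuation.comap_apply, Valuation.comap_apply]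

/-- A product of integer powers of values is the value of the product. [folklore] -/
theorem prod_valuation_zpow_eq {F : Type} [Field F] {Γ : Type} [LinearOrderedCommGroupWithZero Γ]
    (v : Valuation F Γ) (y : Fin 3 → F) (m : Fin 3 → ℤ) :
    (∏ i : Fin 3, v (y i) ^ m i) = v (∏ i : Fin 3, y i ^ m i) := by
  rw [map_prod]
  simp only [map_zpow₀]

/-- The pull-back of a rank-one valuation ring along a field embedding is rank one as soon as the
subfield contains a nonzero element of value `< 1`: its value group is a nontrivial subgroup of an
archimedean group. [folklore] -/
theorem rankOne_comap {F : Type} [Field F] (ι : F →+* K) (O : ValuationSubring K)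
    (hr : Nonempty O.valuation.RankOne) {c : F} (hc0 : c ≠ 0) (hc : O.valuation (ι c) < 1) :
    Nonempty (O.comap ι).valuation.RankOne := by
  obtain ⟨hR⟩ := hr
  have hE := isEquiv_comap_valuation ι O
  haveI : (O.comap ι).valuation.IsNontrivial := by
    refine ⟨c, (Valuation.ne_zero_iff _).mpr hc0, fun h1 => ?_⟩
    exact hc.ne ((comap_valuation_eq_one_iff ι O c).mp h1)
  haveI hA : MulArchimedean (MonoidWithZeroHom.ValueGroup₀ (.ofClass O.valuation)) :=
    Valuation.nonempty_rankOne_iff_mulArchimedean.mp ⟨hR⟩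
  have hle : MonoidWithZeroHom.valueGroup (MonoidWithZeroHom.ofClass (O.valuation.comap ι)) ≤
      MonoidWithZeroHom.valueGroup (MonoidWithZeroHom.ofClass O.valuation) := by
    rw [MonoidWithZeroHom.valueGroup_def, MonoidWithZeroHom.valueGroup_def]
    refine Subgroup.closure_mono fun b hb => ?_
    obtain ⟨x, hx⟩ := (MonoidWithZeroHom.mem_valueMonoid_iff _).mp hb
    exact (MonoidWithZeroHom.mem_valueMonoid_iff _).mpr ⟨ι x, hx⟩
  let j : MonoidWithZeroHom.ValueGroup₀ (.ofClass (O.valuation.comap ι)) →*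
      MonoidWithZeroHom.ValueGroup₀ (.ofClass O.valuation) := WithZero.map' (Subgroup.inclusion hle)
  have hj : StrictMono j := WithZero.map'_strictMono fun _ _ h => h
  haveI : MulArchimedean (MonoidWithZeroHom.ValueGroup₀ (.ofClass (O.valuation.comap ι))) :=
    MulArchimedean.comap j hj
  rw [Valuation.nonempty_rankOne_iff_mulArchimedean]
  exact MulArchimedean.comap hE.symm.orderMonoidIso.toMonoidHom hE.symm.orderMonoidIso.strictMono

/-! ### VI.3 The Hensel datum of a standard-étale presentation -/

/-- A polynomial with coefficients in a subfield, evaluated at an element of the subfield, lies in it.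
[folklore] -/
theorem eval_map_mem_subfield {P : Type} [CommRing P] (ψ : P →+* K) (L : Subfield K)
    (hψ : ∀ q, ψ q ∈ L) {η : K} (hη : η ∈ L) (p : P[X]) : (p.map ψ).eval η ∈ L := by
  induction p using Polynomial.induction_on' with
  | add p q hp hq => simpa using add_mem hp hq
  | monomial n a => simpa using mul_mem (hψ a) (pow_mem hη n)

/-- **Hensel datum of a standard-étale localisation** (the kernel of the dictionary "`K ⊆ F₁^h` ⟺ the
typed Hensel clauses").  Let `A ⊆ O` be a chart with `Frac A = K`, `P → A` a ring map whose image lies in a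
subfield `F₁`, `r ∈ A` with `v r = 0`, and `A[1/r]` STANDARD ÉTALE over `P` (Mathlib
`StandardEtalePresentation`: `A[1/r] ≅ P[X][Y]/(f, Yg - 1)`, `f` monic, `f'` invertible).  Then the image
`η ∈ K` of the standard generator lies in `O`, `K = F₁(η)`, and `η` is a HENSEL ROOT over `O ∩ F₁`:
`f^ψ(η) = 0`, `f^ψ` monic with coefficients in `O ∩ F₁`, `v(f^ψ′(η)) = 0`.  (All of `A[1/r]` maps into `O`
because `v r = 0`.) [folklore] -/
theorem henselDatum_of_standardEtalePresentation (O : ValuationSubring K) (A : Subalgebra k K)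
    (hAO : A.toSubring ≤ O.toSubring) [IsFractionRing A K] (F₁ : IntermediateField k K)
    {P : Type} [CommRing P] [Algebra P A] (hPF : ∀ q : P, ((algebraMap P A q : A) : K) ∈ F₁)
    (r : A) (hr : O.valuation (r : K) = 1)
    (Q : StandardEtalePresentation P (Localization.Away r)) :
    ∃ η : K, η ∈ O ∧ Subfield.closure ((F₁.toSubfield : Set K) ∪ {η}) = ⊤ ∧
      ∃ f : K[X], f.Monic ∧ (∀ i, f.coeff i ∈ O ∧ f.coeff i ∈ F₁.toSubfield) ∧
        f.eval η = 0 ∧ O.valuation ((derivative f).eval η) = 1 := by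
  classical
  have hAO' : ∀ a : A, (a : K) ∈ O := fun a => hAO a.2
  have hAK : ∀ a : A, algebraMap A K a = (a : K) := fun _ => rfl
  have hr0 : (r : K) ≠ 0 := by
    intro h
    rw [h, map_zero] at hr
    exact zero_ne_one hr
  have hunit : IsUnit (algebraMap A K r) := isUnit_iff_ne_zero.mpr hr0
  let φ : Localization.Away r →+* K := IsLocalization.Away.lift r hunit
  have hφA : ∀ a : A, φ (algebraMap A (Localization.Away r) a) = (a : K) := fun a =>
    IsLocalization.Away.lift_eq r hunit a
  let ψ : P →+* K := (algebraMap A K).comp (algebraMap P A)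
  have hψ : ∀ q : P, ψ q = ((algebraMap P A q : A) : K) := fun _ => rfl
  have hφP : φ.comp (algebraMap P (Localization.Away r)) = ψ := by
    rw [IsScalarTower.algebraMap_eq P A (Localization.Away r), ← RingHom.comp_assoc,
      IsLocalization.Away.lift_comp]
  -- `A[1/r]` maps into `O`
  have hφO : ∀ s : Localization.Away r, φ s ∈ O := by
    intro s
    obtain ⟨⟨a, ⟨_, n, rfl⟩⟩, hs⟩ := IsLocalization.surj (Submonoid.powers r) s
    have h1 : φ s * (r : K) ^ n = (a : K) := by
      have := congrArg φ hs
      simpa only [map_mul, map_pow, hφA] using this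
    have h2 : O.valuation (φ s) * O.valuation ((r : K) ^ n) = O.valuation (a : K) := by
      rw [← map_mul, h1]
    rw [map_pow, hr, one_pow, mul_one] at h2
    exact (O.valuation_le_one_iff _).mp (h2 ▸ (O.valuation_le_one_iff _).mpr (hAO' a))
  -- evaluation through `φ`
  have heval : ∀ p : P[X], (p.map ψ).eval (φ Q.x) = φ (aeval Q.x p) := by
    intro p
    rw [eval_map, ← hφP, ← Polynomial.hom_eval₂, ← aeval_def]
  -- the subfield generated by `F₁` and `η`
  set η : K := φ Q.x with hηdef
  set L : Subfield K := Subfield.closure ((F₁.toSubfield : Set K) ∪ {η}) with hLdef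
  have hηL : η ∈ L := Subfield.subset_closure (Set.mem_union_right _ rfl)
  have hF₁L : ∀ z : K, z ∈ F₁ → z ∈ L := fun z hz =>
    Subfield.subset_closure (Set.mem_union_left _ ((IntermediateField.mem_toSubfield _ _).mpr hz))
  have hψL : ∀ q, ψ q ∈ L := fun q => hF₁L _ (hψ q ▸ hPF q)
  have hg0 : φ (aeval Q.x Q.g) ≠ 0 := (Q.hasMap.2.map φ).ne_zero
  have hgL : φ (aeval Q.x Q.g) ∈ L := (heval Q.g) ▸ eval_map_mem_subfield ψ L hψL hηL _
  have hφL : ∀ s : Localization.Away r, φ s ∈ L := by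
    intro s
    obtain ⟨p, n, hp⟩ := Q.exists_mul_aeval_x_g_pow_eq_aeval_x s
    have h1 : φ s * φ (aeval Q.x Q.g) ^ n = (p.map ψ).eval η := by
      rw [← map_pow, ← map_mul, hp, heval]
    have h2 : φ s = (p.map ψ).eval η / φ (aeval Q.x Q.g) ^ n := by
      rw [eq_div_iff (pow_ne_zero _ hg0), h1]
    rw [h2]
    exact div_mem (eval_map_mem_subfield ψ L hψL hηL _) (pow_mem hgL n)
  have hgen : L = ⊤ := by
    refine eq_top_iff.mpr fun z _ => ?_
    obtain ⟨a, b, -, rfl⟩ := IsFractionRing.div_surjective (A := A) z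
    rw [hAK, hAK, ← hφA a, ← hφA b]
    exact div_mem (hφL _) (hφL _)
  -- the Hensel polynomial
  refine ⟨η, hφO _, hgen, Q.f.map ψ, Q.monic_f.map ψ, fun i => ?_, ?_, ?_⟩
  · rw [coeff_map, hψ]
    exact ⟨hAO' _, (IntermediateField.mem_toSubfield _ _).mpr (hPF _)⟩
  · rw [heval, Q.hasMap.1, map_zero]
  · rw [derivative_map, heval]
    obtain ⟨w, hw⟩ := Q.hasMap.isUnit_derivative_f
    have hw' : φ (aeval Q.x (derivative Q.f)) * φ (↑w⁻¹ : Localization.Away r) = 1 := by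
      rw [← map_mul, ← hw, Units.mul_inv, map_one]
    exact (O.valuation_eq_one_iff ⟨_, hφO _⟩).mp (IsUnit.of_mul_eq_one ⟨_, hφO _⟩ (Subtype.ext hw'))

end AdaptedChart

end Summit.ResolutionOfSingularities.ResolutionOfSingularities.Theorems.AdaptedChartHensel
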